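import Summits.Ventures.HSemireg.WedgeWeilOneSided
import Summits.Ventures.HSemireg.WedgeC15General

/-!
# Venture HSemireg — THEOREM R (Weil rank) ON THE p4 CARRIER: the contraction span of `f(Θ) + a·w₊ + b·w₋`
# in an adapted frame of `(V, L)`, stated for the TREE's `ContractionSpan.span ↑L ↑(Ann L) x` literally

HONEST FRAMING. Part of the Lean index of the computation cell `pub-hsemireg` (seat p4 gen 3; FORMULA-N PART B §N.4 / §N.5,
the «p4-carrier bridge» step for THEOREM R).  Finite-dimensional exterior algebra over a field ONLY: no variety, no cohomology
theory, no semiregularity map is constructed here; nothing here says that HC / HC_CM / HC_AV holds; no Literature fact is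
declared or used.

WHAT IS PROVED.  For a `K`-space `V` with an ADAPTED BASIS `bV : Fin (N + N) → V` (`ℓ_a := bV a`, `m_a := bV (N + a)`,
`L := span ℓ` — the bridge data of `WedgeCarrierDictionary.lean`) and a «signature» `p ≤ N`, put
* `f := Ecl bV q N` (`= Σ_m q_m Θ^m/m!`, `Θ = Σ_a ℓ_a ∧ m_a`, the h-part of `WedgeCarrierEcl.lean`),
* `w₊ := wUp bV p = ℓ_p ∧ ⋯ ∧ ℓ_{N-1} ∧ m_{p-1} ∧ ⋯ ∧ m_0` (a top form of the block `⟨ℓ_c (c ≥ p), m_c (c < p)⟩`),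
* `w₋ := wLow bV p = ℓ_0 ∧ ⋯ ∧ ℓ_{p-1} ∧ m_{N-1} ∧ ⋯ ∧ m_p` (a top form of the complementary block).
Then for `a b ≠ 0`, `3 ≤ N - p` (sequel file `WedgeWeilCarrierRank.lean`, `finrank_contractionSpan_weil`):
`dim ContractionSpan.span ↑L ↑(Ann L) (f + a·w₊ + b·w₋) + (p+p)((N+N)-(p+p)) = C(N+N, 2) + p(N-p)·rank H₂(q)`,
i.e. `rank(⌟v ∣ HT²) = C(2N,2) - (4 - ρ)·p(N-p)`; for `N = n + n`, `p = n`, `3 ≤ n` (`finrank_contractionSpan_weil_nn`):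
`dim + 2n = 4n² + n²·ρ` — THEOREM R's `(4 + ρ)n² - 2n`; and the every-degree forms for the bridge's degree-`m` span `S_m`
(`finrank_S_weil_deg`, `finrank_S_weil_nn_deg`).  THIS FILE: the carrier Weil vectors, the dictionary and the TRANSPORT
LEMMA `finrank_S_eq_model`; the assembled statements are in the sequel.  PROOF = TRANSPORT ONLY: th-7's model theorems
(`Wedge.Weil.weilRank`, `…_nn`, `…_deg`, `…_nn_deg`, files `WedgeWeil*.lean`) carried through the carrier bridge
`Φ_ω ∘ Ψ⁻¹` (`WedgeCarrierBridge/Dictionary/Vacuum.lean`, `WedgeC15.lean`): `Φ_ω(Ψ⁻¹ B_{Gm}) ∈ Kˣ·w₊` with NO sign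
(`Φ_up`), `Φ_ω(Ψ⁻¹ B_{Dm}) ∈ Kˣ·w₋` with the tracked sign `(-1)^{(N-p)p}` (`Φ_low`); all units are absorbed into `a, b ≠ 0`.
The geometric DICTIONARY (on a Weil-type abelian `2n`-fold: `V = H¹`, `L = H^{0,1}`, the two blocks = the `K`-eigenspaces
`H¹_±`, `w_± = det H¹_±` the Weil vectors, `Θ` the polarisation — STRUCTURE.md D9 / (F1), theory/FORMULA-N-th7.md PART B §L.3)
is NOT asserted in Lean: the identification of a geometric class with `(q; a, b)` in an adapted Weil frame is the non-Lean
input (th-7); the real-carrier form with that identification as a NAMED HYPOTHESIS is `ContractionRankWeil.lean`.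
References: [BourbakiAlgebre1a3] Ch. III §7, §11 no. 9; [BuchweitzFlenner2008HH] Prop. 6.4.4 (why these operators).
-/

open Module Set Set.powersetCard

namespace Summit.Ventures.HSemireg.WeilCarrier

open Summit.Ventures.HSemireg.WedgeBridge Summit.Ventures.HSemireg.WedgeC15
open Summit.Ventures.HSemireg.Wedge Summit.Ventures.HSemireg.Wedge.Hankel Summit.Ventures.HSemireg.Wedge.Weil
open CliffordAlgebra (contractLeft)
open ExteriorAlgebra (ι)

variable {K : Type*} [Field K] {N : ℕ} {V : Type*} [AddCommGroup V] [Module K V] (bV : Basis (Fin (N + N)) K V)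

/-! ### 1. Block products on the bridge side and on the carrier -/

/-- the upper-block wedge generators `x_p ⋯ x_{k-1}` in `⋀W` (factors `1` below `p`; junk-compatible above `N`).
[cite: BourbakiAlgebre1a3, Ch. III §7 no. 1] -/
noncomputable def xprodFrom (p : ℕ) : ℕ → ExteriorAlgebra K (W K (Lsp bV))
  | 0 => 1
  | k + 1 => xprodFrom p k * (if p ≤ k then XN bV k else 1)

/-- the upper-block contraction generators `y_p ⋯ y_{k-1}` in `⋀W`. [cite: BourbakiAlgebre1a3, Ch. III §7 no. 1] -/
noncomputable def yprodFrom (p : ℕ) : ℕ → ExteriorAlgebra K (W K (Lsp bV))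
  | 0 => 1
  | k + 1 => yprodFrom p k * (if p ≤ k then YN bV k else 1)

/-- the upper-block form `ℓ_p ∧ ⋯ ∧ ℓ_{k-1}` in `Λ V`. [cite: BourbakiAlgebre1a3, Ch. III §7 no. 1] -/
noncomputable def ellprodFrom (p : ℕ) : ℕ → ExteriorAlgebra K V
  | 0 => 1
  | k + 1 => ellprodFrom p k * (if p ≤ k then ι K (ℓN bV k) else 1)

/-- the upper-block vacuum `m_{k-1} ∧ ⋯ ∧ m_p` (REVERSED order, as the bridge's `vac`). [cite: BourbakiAlgebre1a3, Ch. III §7 no. 1] -/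
noncomputable def vacFrom (p : ℕ) : ℕ → ExteriorAlgebra K V
  | 0 => 1
  | k + 1 => (if p ≤ k then ι K (mN bV k) else 1) * vacFrom p k

/-- **`w₊` on the carrier:** `ℓ_p ∧ ⋯ ∧ ℓ_{N-1} ∧ m_{p-1} ∧ ⋯ ∧ m_0`, a top form of the block
`⟨ℓ_c (c ≥ p), m_c (c < p)⟩` (the transposed Weil vector `det V₊^* ∧ det V̄₋^*` of FORMULA-N PART B §L in an adapted
frame). [cite: BourbakiAlgebre1a3, Ch. III §7 no. 1] -/
noncomputable def wUp (p : ℕ) : ExteriorAlgebra K V := ellprodFrom bV p N * vac bV p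

/-- **`w₋` on the carrier:** `ℓ_0 ∧ ⋯ ∧ ℓ_{p-1} ∧ m_{N-1} ∧ ⋯ ∧ m_p`, a top form of the complementary block
`⟨ℓ_c (c < p), m_c (c ≥ p)⟩`. [cite: BourbakiAlgebre1a3, Ch. III §7 no. 1] -/
noncomputable def wLow (p : ℕ) : ExteriorAlgebra K V := ellprod bV p * vacFrom bV p N

/-- the POINT-TYPE class `LMprod N = (ℓ_{N-1} ∧ m_{N-1}) ⋯ (ℓ_0 ∧ m_0)` (`= Θ^N/N!`, a top form of `V`; junk-compatible).
[cite: BourbakiAlgebre1a3, Ch. III §7 no. 1] -/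
noncomputable def LMprod : ℕ → ExteriorAlgebra K V
  | 0 => 1
  | k + 1 => LM bV k * LMprod k

/-- `Ecl` of the zero sequence vanishes. -/
lemma Ecl_zero_seq : ∀ k : ℕ, Ecl bV (fun _ => (0 : K)) k = 0
  | 0 => by rw [Ecl, map_zero]
  | k + 1 => by rw [Ecl, Ecl_zero_seq k, zero_add, mul_zero]

/-- `Ecl` of the unit sequence `δ_0` is `1` in every length. -/
lemma Ecl_delta_zero : ∀ k : ℕ, Ecl bV (fun m => if m = 0 then (1 : K) else 0) k = 1
  | 0 => by rw [Ecl, if_pos rfl, map_one]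
  | k + 1 => by
    have hs : (fun m => if m + 1 = 0 then (1 : K) else 0) = fun _ => (0 : K) := by
      funext m; rw [if_neg (Nat.succ_ne_zero m)]
    rw [Ecl, Ecl_delta_zero k, hs, Ecl_zero_seq, mul_zero, add_zero]

/-- `Ecl` of `δ_M` in length `k < M` vanishes. -/
lemma Ecl_delta_of_lt : ∀ (k M : ℕ), k < M → Ecl bV (fun m => if m = M then (1 : K) else 0) k = 0
  | 0, M, h => by rw [Ecl, if_neg (by omega), map_zero]
  | k + 1, M, h => by
    have hs : (fun m => if m + 1 = M then (1 : K) else 0) = fun m => if m = M - 1 then (1 : K) else 0 := by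
      funext m
      by_cases hm : m + 1 = M
      · rw [if_pos hm, if_pos (by omega)]
      · rw [if_neg hm, if_neg (by omega)]
    rw [Ecl, Ecl_delta_of_lt k M (by omega), hs, Ecl_delta_of_lt k (M - 1) (by omega), mul_zero, add_zero]

/-- `Ecl` of `δ_k` in length `k` is the point-type class: `Ecl δ_k k = (ℓ_{k-1} ∧ m_{k-1}) ⋯ (ℓ_0 ∧ m_0)`. -/
lemma Ecl_delta_top : ∀ k : ℕ, Ecl bV (fun m => if m = k then (1 : K) else 0) k = LMprod bV k
  | 0 => by rw [Ecl, if_pos rfl, map_one, LMprod]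
  | k + 1 => by
    have hs : (fun m => if m + 1 = k + 1 then (1 : K) else 0) = fun m => if m = k then (1 : K) else 0 := by
      funext m
      by_cases hm : m = k
      · rw [if_pos hm, if_pos (by omega)]
      · rw [if_neg hm, if_neg (by omega)]
    rw [Ecl, Ecl_delta_of_lt bV k (k + 1) (Nat.lt_succ_self k), hs, Ecl_delta_top k, zero_add, LMprod]

/-- **DICTIONARY (two-ended h-part):** `Ecl (c₀·δ_0 + c_N·δ_N) N = c₀·1 + c_N·(ℓ_{N-1} ∧ m_{N-1}) ⋯ (ℓ_0 ∧ m_0)` — «`c₀ + c_N·pt`»,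
the h-part of Hankel rank `2` carried by every `2`-secant factor / box image. [cite: BourbakiAlgebre1a3, Ch. III §7 no. 1] -/
theorem Ecl_twoEnded (c₀ cN : K) :
    Ecl bV (fun m => (if m = 0 then c₀ else 0) + (if m = N then cN else 0)) N =
      algebraMap K _ c₀ + cN • LMprod bV N := by
  have h1 : (fun m => (if m = 0 then c₀ else 0) + (if m = N then cN else 0)) =
      fun m => (fun j => c₀ * (if j = 0 then (1 : K) else 0)) m + (fun j => cN * (if j = N then (1 : K) else 0)) m := by
    funext m; simp only [mul_ite, mul_one, mul_zero]
  rw [h1, Ecl_add, Ecl_smul, Ecl_smul, Ecl_delta_zero, Ecl_delta_top, Algebra.algebraMap_eq_smul_one]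

/-! ### 2. Carrier computations (sign-free for `w₊`, one tracked sign for `w₋`) -/

/-- below `p` the upper-block products are `1`. -/
lemma xprodFrom_of_le {p k : ℕ} (h : k ≤ p) : xprodFrom bV p k = 1 := by
  induction k with | zero => rfl | succ k ih => rw [xprodFrom, if_neg (by omega), mul_one, ih (by omega)]

/-- below `p` the upper-block products are `1`. -/
lemma yprodFrom_of_le {p k : ℕ} (h : k ≤ p) : yprodFrom bV p k = 1 := by
  induction k with | zero => rfl | succ k ih => rw [yprodFrom, if_neg (by omega), mul_one, ih (by omega)]

/-- below `p` the upper-block products are `1`. -/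
lemma ellprodFrom_of_le {p k : ℕ} (h : k ≤ p) : ellprodFrom bV p k = 1 := by
  induction k with | zero => rfl | succ k ih => rw [ellprodFrom, if_neg (by omega), mul_one, ih (by omega)]

/-- below `p` the upper-block vacuum is `1`. -/
lemma vacFrom_of_le {p k : ℕ} (h : k ≤ p) : vacFrom bV p k = 1 := by
  induction k with | zero => rfl | succ k ih => rw [vacFrom, if_neg (by omega), one_mul, ih (by omega)]

/-- `ρ(x_k) z = ℓ_k ∧ z` (junk-compatible). -/
lemma ρ_XN (k : ℕ) (z : ExteriorAlgebra K V) : ρ K (Lsp bV) (XN bV k) z = ι K (ℓN bV k) * z := by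
  by_cases hk : k < N
  · rw [XN, dif_pos hk, ρ_Xg, ℓN, dif_pos hk]
  · rw [XN, dif_neg hk, ℓN, dif_neg hk, map_zero, LinearMap.zero_apply, map_zero, zero_mul]

/-- `ρ(y_k) z = θ_k ⌟ z` (junk-compatible). -/
lemma ρ_YN (k : ℕ) (z : ExteriorAlgebra K V) : ρ K (Lsp bV) (YN bV k) z = contractLeft (θN bV k) z := by
  by_cases hk : k < N
  · rw [YN, dif_pos hk, ρ_Yg, θN, dif_pos hk]
  · rw [YN, dif_neg hk, θN, dif_neg hk, map_zero, LinearMap.zero_apply, map_zero, LinearMap.zero_apply]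

/-- `ρ(x_p ⋯ x_{k-1}) z = (ℓ_p ∧ ⋯ ∧ ℓ_{k-1}) ∧ z`. -/
lemma ρ_xprodFrom (p : ℕ) : ∀ (k : ℕ) (z : ExteriorAlgebra K V),
    ρ K (Lsp bV) (xprodFrom bV p k) z = ellprodFrom bV p k * z
  | 0, z => by rw [xprodFrom, ellprodFrom, map_one, Module.End.one_apply, one_mul]
  | k + 1, z => by
    by_cases h : p ≤ k
    · rw [xprodFrom, ellprodFrom, if_pos h, if_pos h, map_mul (ρ K (Lsp bV)), Module.End.mul_apply, ρ_XN,
        ρ_xprodFrom p k,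
        mul_assoc]
    · rw [xprodFrom, ellprodFrom, if_neg h, if_neg h, mul_one, mul_one, ρ_xprodFrom p k]

/-- `θ_k(m_j) = [k = j]` on the ℕ-indexed letters (`k < N`). -/
lemma θN_mN {k j : ℕ} (hk : k < N) : θN bV k (mN bV j) = if k = j then (1 : K) else 0 := by
  rw [θN, dif_pos hk]
  by_cases hj : j < N
  · rw [mN, dif_pos hj, θ_m]
    by_cases hkj : k = j
    · subst hkj; rw [if_pos rfl, if_pos rfl]
    · rw [if_neg (fun h => hkj (by simpa using congrArg Fin.val h)), if_neg hkj]
  · rw [mN, dif_neg hj, map_zero, if_neg (by omega)]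

/-- one contraction peels the top of the vacuum: `θ_k ⌟ (m_k ∧ ω_k) = ω_k`. -/
lemma ρ_YN_vac_succ {k : ℕ} (hk : k < N) : ρ K (Lsp bV) (YN bV k) (vac bV (k + 1)) = vac bV k := by
  rw [ρ_YN, vac, CliffordAlgebra.contractLeft_ι_mul, θN_mN bV hk, if_pos rfl, one_smul, contract_vac bV hk (le_refl k),
    mul_zero, sub_zero]

/-- **sign-free peeling of the upper block:** `ρ(y_p ⋯ y_{k-1}) (m_{k-1} ∧ ⋯ ∧ m_0) = m_{p-1} ∧ ⋯ ∧ m_0`. -/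
lemma ρ_yprodFrom_vac (p : ℕ) : ∀ k : ℕ, p ≤ k → k ≤ N → ρ K (Lsp bV) (yprodFrom bV p k) (vac bV k) = vac bV p
  | 0, h0, _ => by
    obtain rfl : p = 0 := Nat.le_zero.mp h0
    rw [yprodFrom, map_one, Module.End.one_apply]
  | k + 1, hpk, hkN => by
    by_cases h : p ≤ k
    · rw [yprodFrom, if_pos h, map_mul (ρ K (Lsp bV)), Module.End.mul_apply, ρ_YN_vac_succ bV (by omega),
        ρ_yprodFrom_vac p k h (by omega)]
    · obtain rfl : p = k + 1 := by omega
      rw [yprodFrom_of_le bV (le_refl _), map_one, Module.End.one_apply]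

/-- **DICTIONARY (`w₊`), EXACT:** `Φ_ω(x_p ⋯ x_{N-1} · y_p ⋯ y_{N-1}) = w₊`. [cite: BourbakiAlgebre1a3, Ch. III §11 no. 9] -/
theorem Φ_up {p : ℕ} (hp : p ≤ N) :
    WedgeBridge.Φ K (Lsp bV) (vacuum bV) (xprodFrom bV p N * yprodFrom bV p N) = wUp bV p := by
  rw [Φ_mul, Φ_apply, vacuum, ρ_yprodFrom_vac bV p N hp (le_refl N), ρ_xprodFrom, wUp]

/-- the vacuum splits off its upper block: `ω_k = (m_{k-1} ∧ ⋯ ∧ m_p) ∧ ω_p` for `p ≤ k`. -/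
lemma vac_eq_vacFrom_mul (p : ℕ) : ∀ k : ℕ, p ≤ k → vac bV k = vacFrom bV p k * vac bV p
  | 0, h0 => by
    obtain rfl : p = 0 := Nat.le_zero.mp h0
    rw [vacFrom, one_mul]
  | k + 1, hpk => by
    by_cases h : p ≤ k
    · rw [vac, vacFrom, if_pos h, vac_eq_vacFrom_mul p k h, mul_assoc]
    · obtain rfl : p = k + 1 := by omega
      rw [vacFrom_of_le bV (le_refl _), one_mul]

/-- a lower contraction anticommutes past the upper-block vacuum: `θ_c ⌟ ((m_{k-1} ∧ ⋯ ∧ m_p) ∧ z) =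
(-1)^{k-p} (m_{k-1} ∧ ⋯ ∧ m_p) ∧ (θ_c ⌟ z)` for `c < p`. [cite: BourbakiAlgebre1a3, Ch. III §11 no. 9] -/
lemma contract_vacFrom_mul {c p : ℕ} (hc : c < p) (hcN : c < N) :
    ∀ (k : ℕ) (z : ExteriorAlgebra K V), contractLeft (θN bV c) (vacFrom bV p k * z) =
      ((-1 : K) ^ (k - p)) • (vacFrom bV p k * contractLeft (θN bV c) z)
  | 0, z => by rw [vacFrom, one_mul, one_mul, Nat.zero_sub, pow_zero, one_smul]
  | k + 1, z => by
    by_cases h : p ≤ k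
    · rw [vacFrom, if_pos h, mul_assoc, CliffordAlgebra.contractLeft_ι_mul, θN_mN bV hcN, if_neg (by omega), zero_smul,
        zero_sub, contract_vacFrom_mul hc hcN k z, mul_smul_comm, ← mul_assoc, ← neg_smul,
        show k + 1 - p = (k - p) + 1 by omega, pow_succ, mul_neg_one]
    · rw [vacFrom, if_neg h, one_mul, contract_vacFrom_mul hc hcN k z, show k + 1 - p = 0 by omega,
        show k - p = 0 by omega]

/-- **peeling the LOWER block through the upper vacuum** costs the sign `(-1)^{(N-p)k}`:
`ρ(y_0 ⋯ y_{k-1}) ((m_{N-1} ∧ ⋯ ∧ m_p) ∧ ω_k) = (-1)^{(N-p)k} · (m_{N-1} ∧ ⋯ ∧ m_p)` for `k ≤ p ≤ N`. -/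
lemma ρ_yprod_vacFrom_mul {p : ℕ} (hp : p ≤ N) :
    ∀ k : ℕ, k ≤ p → ρ K (Lsp bV) (yprod bV k) (vacFrom bV p N * vac bV k) =
      ((-1 : K) ^ ((N - p) * k)) • vacFrom bV p N
  | 0, _ => by rw [yprod, vac, map_one, Module.End.one_apply, mul_one, mul_zero, pow_zero, one_smul]
  | k + 1, hk => by
    have hkN : k < N := by omega
    rw [yprod, map_mul (ρ K (Lsp bV)), Module.End.mul_apply, ρ_YN, vac, contract_vacFrom_mul bV (by omega) hkN,
      CliffordAlgebra.contractLeft_ι_mul, θN_mN bV hkN, if_pos rfl, one_smul, contract_vac bV hkN (le_refl k), mul_zero,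
      sub_zero, map_smul, ρ_yprod_vacFrom_mul hp k (by omega), smul_smul, ← pow_add,
      show N - p + (N - p) * k = (N - p) * (k + 1) by ring]

/-- **DICTIONARY (`w₋`), with its sign:** `Φ_ω(x_0 ⋯ x_{p-1} · y_0 ⋯ y_{p-1}) = (-1)^{(N-p)p} · w₋`.
[cite: BourbakiAlgebre1a3, Ch. III §11 no. 9] -/
theorem Φ_low {p : ℕ} (hp : p ≤ N) :
    WedgeBridge.Φ K (Lsp bV) (vacuum bV) (xprod bV p * yprod bV p) = ((-1 : K) ^ ((N - p) * p)) • wLow bV p := by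
  rw [Φ_mul, Φ_apply, vacuum, vac_eq_vacFrom_mul bV p N hp, ρ_yprod_vacFrom_mul bV hp p (le_refl p), map_smul,
    ρ_xprod bV hp, wLow]

/-! ### 3. Model side: `Ψ` of the block products are UNIT multiples of th-7's block monomials `E_{Gm}`, `E_{Dm}` -/

/-- the upper `x`-indices `p ≤ i < k` of `In N`. -/
def XS (p k : ℕ) : Finset (In N) := Finset.univ.filter fun i => p ≤ (i : ℕ) ∧ (i : ℕ) < k

/-- the upper `y`-indices `N + p ≤ i < N + k` of `In N`. -/
def YS (p k : ℕ) : Finset (In N) := Finset.univ.filter fun i => N + p ≤ (i : ℕ) ∧ (i : ℕ) < N + k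

/-- `Ψ(x_p ⋯ x_{k-1})` is a unit multiple of the monomial on the `y`-indices of the pairs `p ≤ c < k`
(`Ψ(x_c) = Y_c`). -/
lemma Ψ_xprodFrom (p : ℕ) : ∀ k : ℕ, k ≤ N →
    ∃ c : K, c ≠ 0 ∧ Ψ bV (xprodFrom bV p k) = c • B K (In N) (YS (N := N) p k)
  | 0, _ => ⟨1, one_ne_zero, by
      have h0 : YS (N := N) p 0 = ∅ := by
        ext i; simp only [YS, Finset.mem_filter, Finset.mem_univ, true_and, Finset.notMem_empty, iff_false]; omega
      rw [xprodFrom, map_one, h0, B_empty K, one_smul]⟩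
  | k + 1, hk => by
    obtain ⟨c, hc, hΨ⟩ := Ψ_xprodFrom p k (by omega)
    by_cases h : p ≤ k
    · have hkN : k < N := by omega
      have hdisj : Disjoint (YS (N := N) p k) {yI k hkN} := by
        rw [Finset.disjoint_singleton_right]
        simp only [YS, Finset.mem_filter, Finset.mem_univ, true_and, yI]; omega
      have hset : YS (N := N) p k ∪ {yI k hkN} = YS (N := N) p (k + 1) := by
        ext i
        simp only [YS, Finset.mem_union, Finset.mem_filter, Finset.mem_univ, true_and, Finset.mem_singleton,
          Fin.ext_iff, yI]
        omega
      refine ⟨c * u K (YS (N := N) p k) {yI k hkN}, mul_ne_zero hc ((u_ne_zero_iff K).mpr hdisj), ?_⟩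
      rw [xprodFrom, if_pos h, map_mul, hΨ, Ψ_XN, Y, dif_pos hkN, smul_mul_assoc, B_mul_B, smul_smul, hset]
    · have hset : YS (N := N) p (k + 1) = YS (N := N) p k := by
        ext i; simp only [YS, Finset.mem_filter, Finset.mem_univ, true_and]; omega
      exact ⟨c, hc, by rw [xprodFrom, if_neg h, mul_one, hΨ, hset]⟩

/-- `Ψ(y_p ⋯ y_{k-1})` is a unit multiple of the monomial on the `x`-indices of the pairs `p ≤ c < k`
(`Ψ(y_c) = X_c`). -/
lemma Ψ_yprodFrom (p : ℕ) : ∀ k : ℕ, k ≤ N →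
    ∃ c : K, c ≠ 0 ∧ Ψ bV (yprodFrom bV p k) = c • B K (In N) (XS (N := N) p k)
  | 0, _ => ⟨1, one_ne_zero, by
      have h0 : XS (N := N) p 0 = ∅ := by
        ext i; simp only [XS, Finset.mem_filter, Finset.mem_univ, true_and, Finset.notMem_empty, iff_false]; omega
      rw [yprodFrom, map_one, h0, B_empty K, one_smul]⟩
  | k + 1, hk => by
    obtain ⟨c, hc, hΨ⟩ := Ψ_yprodFrom p k (by omega)
    by_cases h : p ≤ k
    · have hkN : k < N := by omega
      have hdisj : Disjoint (XS (N := N) p k) {xI k hkN} := by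
        rw [Finset.disjoint_singleton_right]
        simp only [XS, Finset.mem_filter, Finset.mem_univ, true_and, xI]; omega
      have hset : XS (N := N) p k ∪ {xI k hkN} = XS (N := N) p (k + 1) := by
        ext i
        simp only [XS, Finset.mem_union, Finset.mem_filter, Finset.mem_univ, true_and, Finset.mem_singleton,
          Fin.ext_iff, xI]
        omega
      refine ⟨c * u K (XS (N := N) p k) {xI k hkN}, mul_ne_zero hc ((u_ne_zero_iff K).mpr hdisj), ?_⟩
      rw [yprodFrom, if_pos h, map_mul, hΨ, Ψ_YN, X, dif_pos hkN, smul_mul_assoc, B_mul_B, smul_smul, hset]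
    · have hset : XS (N := N) p (k + 1) = XS (N := N) p k := by
        ext i; simp only [XS, Finset.mem_filter, Finset.mem_univ, true_and]; omega
      exact ⟨c, hc, by rw [yprodFrom, if_neg h, mul_one, hΨ, hset]⟩

/-- the bridge's full lower products are the `p = 0` upper products. -/
lemma xprod_eq_xprodFrom : ∀ k : ℕ, xprod bV k = xprodFrom bV 0 k
  | 0 => rfl
  | k + 1 => by rw [xprod, xprodFrom, if_pos (Nat.zero_le k), xprod_eq_xprodFrom k]

/-- the bridge's full lower products are the `p = 0` upper products. -/
lemma yprod_eq_yprodFrom : ∀ k : ℕ, yprod bV k = yprodFrom bV 0 k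
  | 0 => rfl
  | k + 1 => by rw [yprod, yprodFrom, if_pos (Nat.zero_le k), yprod_eq_yprodFrom k]

/-- the upper `y`- and `x`-indices together are th-7's upper block `Gm N p`. -/
lemma YS_union_XS_top (p : ℕ) : YS (N := N) p N ∪ XS (N := N) p N = Gm N p := by
  ext i
  have hi := i.2
  simp only [YS, XS, Gm, Dm, Finset.mem_union, Finset.mem_filter, Finset.mem_univ, true_and, Finset.mem_compl]
  omega

/-- the lower `y`- and `x`-indices together are th-7's lower block `Dm N p`. -/
lemma YS_union_XS_low (p : ℕ) : YS (N := N) 0 p ∪ XS (N := N) 0 p = Dm N p := by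
  ext i
  simp only [YS, XS, Dm, Finset.mem_union, Finset.mem_filter, Finset.mem_univ, true_and, Nat.add_zero]
  omega

/-- `y`-indices and `x`-indices are disjoint. -/
lemma disjoint_YS_XS (p k p' k' : ℕ) (hk' : k' ≤ N) : Disjoint (YS (N := N) p k) (XS (N := N) p' k') := by
  rw [Finset.disjoint_left]
  intro i hy hx
  simp only [YS, XS, Finset.mem_filter, Finset.mem_univ, true_and] at hy hx
  omega

/-- **`Ψ(x_p ⋯ x_{N-1} · y_p ⋯ y_{N-1}) = unit · E_{Gm N p}`** (th-7's `w₊` in the model). -/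
theorem Ψ_up (p : ℕ) :
    ∃ c : K, c ≠ 0 ∧ Ψ bV (xprodFrom bV p N * yprodFrom bV p N) = c • B K (In N) (Gm N p) := by
  obtain ⟨c₁, hc₁, h₁⟩ := Ψ_xprodFrom bV p N (le_refl N)
  obtain ⟨c₂, hc₂, h₂⟩ := Ψ_yprodFrom bV p N (le_refl N)
  have hd := disjoint_YS_XS (N := N) p N p N (le_refl N)
  refine ⟨c₁ * c₂ * u K (YS (N := N) p N) (XS (N := N) p N),
    mul_ne_zero (mul_ne_zero hc₁ hc₂) ((u_ne_zero_iff K).mpr hd), ?_⟩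
  rw [map_mul, h₁, h₂, smul_mul_smul_comm, B_mul_B, smul_smul, YS_union_XS_top]

/-- **`Ψ(x_0 ⋯ x_{p-1} · y_0 ⋯ y_{p-1}) = unit · E_{Dm N p}`** (th-7's `w₋` in the model). -/
theorem Ψ_low {p : ℕ} (hp : p ≤ N) :
    ∃ c : K, c ≠ 0 ∧ Ψ bV (xprod bV p * yprod bV p) = c • B K (In N) (Dm N p) := by
  obtain ⟨c₁, hc₁, h₁⟩ := Ψ_xprodFrom bV 0 p hp
  obtain ⟨c₂, hc₂, h₂⟩ := Ψ_yprodFrom bV 0 p hp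
  have hd := disjoint_YS_XS (N := N) 0 p 0 p hp
  refine ⟨c₁ * c₂ * u K (YS (N := N) 0 p) (XS (N := N) 0 p),
    mul_ne_zero (mul_ne_zero hc₁ hc₂) ((u_ne_zero_iff K).mpr hd), ?_⟩
  rw [xprod_eq_xprodFrom, yprod_eq_yprodFrom, map_mul, h₁, h₂, smul_mul_smul_comm, B_mul_B, smul_smul,
    YS_union_XS_low]

/-! ### 4. Transport: the carrier span of `f + a·w₊ + b·w₋` has the model rank of th-7's `vW p q a' b'` -/

/-- **TRANSPORT LEMMA.** For every degree `k`: `dim S_k(Ecl q N + a·w₊ + b·w₋)` equals the wedge-model rank of th-7's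
`vW N p q a' b'` for some `a', b'` that are nonzero as soon as `a, b` are (the units of `Ψ_up` / `Ψ_low` and the sign
of `Φ_low` are absorbed). [cite: BourbakiAlgebre1a3, Ch. III §11 no. 9] -/
theorem finrank_S_eq_model {p : ℕ} (hp : p ≤ N) (q : ℕ → K) (a b : K) (k : ℕ) :
    ∃ a' b' : K, (a ≠ 0 → a' ≠ 0) ∧ (b ≠ 0 → b' ≠ 0) ∧
      Module.finrank K (S K (Lsp bV) k (Ecl bV q N + a • wUp bV p + b • wLow bV p)) =
        Module.finrank K (LinearMap.range (Wedge.Hankel.wedge K N k (vW K N p q a' b'))) := by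
  obtain ⟨c₁, hc₁, h₁⟩ := Ψ_up bV p
  obtain ⟨c₂, hc₂, h₂⟩ := Ψ_low bV hp
  set ε : K := (-1 : K) ^ ((N - p) * p) with hε
  have hεε : ε * ε = 1 := by rw [hε, ← mul_pow, neg_one_mul, neg_neg, one_pow]
  have hε0 : ε ≠ 0 := fun h => by rw [h, mul_zero] at hεε; exact zero_ne_one hεε
  let v' : ExteriorAlgebra K (W K (Lsp bV)) :=
    gw bV q N + a • (xprodFrom bV p N * yprodFrom bV p N) + (b * ε) • (xprod bV p * yprod bV p)
  have hΦ : WedgeBridge.Φ K (Lsp bV) (vacuum bV) v' = Ecl bV q N + a • wUp bV p + b • wLow bV p := by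
    simp only [v', map_add, map_smul, Φ_gw, Φ_up bV hp, Φ_low bV hp, smul_smul, ← hε, mul_assoc, hεε, mul_one]
  have hΨ : Ψ bV v' = vW K N p q (a * c₁) (b * ε * c₂) := by
    simp only [v', map_add, map_smul, Ψ_gw, h₁, h₂, smul_smul, vW]
  refine ⟨a * c₁, b * ε * c₂, fun ha => mul_ne_zero ha hc₁, fun hb => mul_ne_zero (mul_ne_zero hb hε0) hc₂, ?_⟩
  rw [← hΦ, finrank_S_eq_of_injective (Φ_vacuum_injective bV) k v', finrank_range_wedge_eq, hΨ]

/-- **TRANSPORT LEMMA, one-sided** (`v = f + a·w₊`): `dim S_k(Ecl q N + a·w₊)` is the wedge-model rank of th-7's `vW1 N p q a'`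
with `a' ≠ 0` whenever `a ≠ 0`. [cite: BourbakiAlgebre1a3, Ch. III §11 no. 9] -/
theorem finrank_S_eq_model_one {p : ℕ} (hp : p ≤ N) (q : ℕ → K) (a : K) (k : ℕ) :
    ∃ a' : K, (a ≠ 0 → a' ≠ 0) ∧
      Module.finrank K (S K (Lsp bV) k (Ecl bV q N + a • wUp bV p)) =
        Module.finrank K (LinearMap.range (Wedge.Hankel.wedge K N k (vW1 K N p q a'))) := by
  obtain ⟨c₁, hc₁, h₁⟩ := Ψ_up bV p
  let v' : ExteriorAlgebra K (W K (Lsp bV)) := gw bV q N + a • (xprodFrom bV p N * yprodFrom bV p N)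
  have hΦ : WedgeBridge.Φ K (Lsp bV) (vacuum bV) v' = Ecl bV q N + a • wUp bV p := by
    simp only [v', map_add, map_smul, Φ_gw, Φ_up bV hp]
  have hΨ : Ψ bV v' = vW1 K N p q (a * c₁) := by
    simp only [v', map_add, map_smul, Ψ_gw, h₁, smul_smul, vW1]
  refine ⟨a * c₁, fun ha => mul_ne_zero ha hc₁, ?_⟩
  rw [← hΦ, finrank_S_eq_of_injective (Φ_vacuum_injective bV) k v', finrank_range_wedge_eq, hΨ]

end Summit.Ventures.HSemireg.WeilCarrier
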